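import Summits.SmoothPoincare4.SmoothPoincare4.Theorems.EntropyRungBakryEmeryLogSobolevGaffneyCutoff
import Summits.SmoothPoincare4.SmoothPoincare4.Theorems.EntropyRungNoncompactShrinkerGapHeatGradientDecay
import HarnessLib

/-!
# The time-derivative (`H¹` in time) estimate of the weighted heat flow on a complete manifold,
# with first-order (Gaffney) cut-offs
# (support item `EntropyRung.BakryEmeryLogSobolev`, stmt-SmoothPoincare4-16587)

Setting: `M` modelled on `ℝⁿ` (Hausdorff, second countable, `T₃`, Borel — NOT compact), `g`
Riemannian with its Levi-Civita connection, `V` smooth (NO further assumption on `V`),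
`L = Δ_g − g⁻¹(dV, d·)`, weight `e^{-V} dV_g`, Gaffney cut-offs `η_k ∈ C_c^∞`, `0 ≤ η_k ≤ 1`,
`η_k → 1` pointwise, `|∇η_k|² ≤ C₀/(k+1)²` (`EntropyRungBakryEmeryLogSobolevGaffneyCutoff.lean`).

* `integral_derivSq_cutoffSq_le` — with ONE cut-off `η`: for a solution `∂ₛρ = Lρ` on `[0, T]`
  smooth on `M × O` (`O ⊇ [0,T]` open),
  `∫∫_{M×(0,T)} η² (∂ₛρ)² e^{-V} ≤ D(0) − D(T) + 4 ∫∫_{M×(0,T)} |∇η|² |∇ρ|² e^{-V}`,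
  `D(s) = ∫ |∇ρ(s)|² η² e^{-V}`: `D' = 2∫ g⁻¹(dρ, d(Lρ)) η² e^{-V} = −2∫ η² (Lρ)² e^{-V}
  − 4 ∫ (Lρ) η g⁻¹(dη, dρ) e^{-V}` (`deriv_gradSq_of_heatFlow_isOpen`,
  `integral_mul_cutoffSq_mul_weightedLaplacian` with `a = Lρ`) and the first-order absorption
  `−4 (Lρ) η g⁻¹(dη, dρ) ≤ η² (Lρ)² + 4 |∇η|² |∇ρ|²`;
* `gaffney_derivEstimate` — **with Gaffney cut-offs: if `|∇ρ|² e^{-V}` is integrable on the strip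
  (`gaffney_energyEstimate`) and at `s = 0`, then `(∂ₛρ)² e^{-V} = (Lρ)² e^{-V}` is integrable on the
  strip and `∫∫_{M×(0,T)} (∂ₛρ)² e^{-V} ≤ ∫ |∇ρ(0)|² e^{-V}`** (Fatou in `k`).

This is the second step of the `L²` ("finite energy") route of Bakry–Gentil–Ledoux (2014), §3.2
(`∂_t P_t f ∈ 𝕃²`), justified on the complete manifold with cut-offs `ζ_k`, `Γ(ζ_k) ≤ 1/k`.
Everything is proved; no definitions, no named facts.

## References

* [BakryGentilLedoux2014] D. Bakry, I. Gentil, M. Ledoux (2014), §3.2 (pp. 141–147), §1.4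
  ((1.4.3)–(1.4.4), `∂_t P_t f = L P_t f`) and §3.1.8 (energy decay).
* [Grigoryan2009] A. Grigor'yan (2009), §4.3 and Ch. 7 (`𝕃²` theory of the heat semigroup).
-/

noncomputable section

set_option linter.dupNamespace false

open scoped Manifold ContDiff ENNReal NNReal Topology
open MeasureTheory Set Filter
open Literature.Geometry.Lorentzian Literature.Geometry.Riemannian

namespace Summit.SmoothPoincare4.SmoothPoincare4.Theorems.BakryEmeryComplete

open NoncompactShrinkerGapHeat NoncompactShrinkerGapHeat.CutoffToolkit

section TimeDerivative

variable {n : ℕ} {M : Type*} [TopologicalSpace M] [T2Space M] [SecondCountableTopology M]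
  [ChartedSpace (EuclideanSpace ℝ (Fin n)) M] [IsManifold (𝓡 n) ∞ M] [T3Space M]
  [MeasurableSpace M] [BorelSpace M]
  {g : PseudoRiemannianMetric (𝓡 n) ∞ (EuclideanSpace ℝ (Fin n)) (TangentSpace (𝓡 n) : M → Type _)}
  [g.HasLeviCivita]

omit [T2Space M] [SecondCountableTopology M] [T3Space M] [MeasurableSpace M] [BorelSpace M]
  [g.HasLeviCivita] in
/-- **First-order absorption, pointwise**: `−4 A η g⁻¹(dη, dρ) ≤ η² A² + 4 |∇η|² |∇ρ|²` for any real
`A` (`|g⁻¹(dη, dρ)| ≤ |∇η| |∇ρ|`, `2xy ≤ x² + y²`). [folklore] -/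
theorem neg_four_mul_mul_innerDual_le (hg : g.IsRiemannian) (ρ η : M → ℝ) (A : ℝ) (x : M) :
    -(4 * (A * η x * g.innerDual x (mvfderiv (𝓡 n) η x).toLinearMap (mvfderiv (𝓡 n) ρ x).toLinearMap)) ≤
      η x ^ 2 * A ^ 2 + 4 * (g.gradSq η x * g.gradSq ρ x) := by
  have hI := abs_innerDual_le_sqrt_gradSq_mul hg η ρ x
  set I := g.innerDual x (mvfderiv (𝓡 n) η x).toLinearMap (mvfderiv (𝓡 n) ρ x).toLinearMap
  have hη2 : Real.sqrt (g.gradSq η x) ^ 2 = g.gradSq η x := Real.sq_sqrt (g.gradSq_nonneg hg η x)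
  have hρ2 : Real.sqrt (g.gradSq ρ x) ^ 2 = g.gradSq ρ x := Real.sq_sqrt (g.gradSq_nonneg hg ρ x)
  have h1 : |4 * (A * η x * I)| ≤
      2 * (|η x| * |A|) * (2 * Real.sqrt (g.gradSq η x) * Real.sqrt (g.gradSq ρ x)) := by
    rw [abs_mul, abs_mul, abs_mul, abs_of_pos (by norm_num : (0 : ℝ) < 4)]
    have h0 : 0 ≤ |A| * |η x| := mul_nonneg (abs_nonneg _) (abs_nonneg _)
    calc 4 * (|A| * |η x| * |I|)
        ≤ 4 * (|A| * |η x| * (Real.sqrt (g.gradSq η x) * Real.sqrt (g.gradSq ρ x))) :=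
          mul_le_mul_of_nonneg_left (mul_le_mul_of_nonneg_left hI h0) (by norm_num)
      _ = 2 * (|η x| * |A|) * (2 * Real.sqrt (g.gradSq η x) * Real.sqrt (g.gradSq ρ x)) := by ring
  have h2 : 2 * (|η x| * |A|) * (2 * Real.sqrt (g.gradSq η x) * Real.sqrt (g.gradSq ρ x)) ≤
      (|η x| * |A|) ^ 2 + (2 * Real.sqrt (g.gradSq η x) * Real.sqrt (g.gradSq ρ x)) ^ 2 :=
    two_mul_le_add_sq _ _
  have h3 : (|η x| * |A|) ^ 2 + (2 * Real.sqrt (g.gradSq η x) * Real.sqrt (g.gradSq ρ x)) ^ 2 =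
      η x ^ 2 * A ^ 2 + 4 * (g.gradSq η x * g.gradSq ρ x) := by
    rw [mul_pow, mul_pow, mul_pow, sq_abs, sq_abs, hη2, hρ2]; ring
  linarith [neg_abs_le (4 * (A * η x * I)), h1, h2, h3]

/-- **The time-derivative inequality with one first-order cut-off.** For `V` smooth, `η ∈ C_c^∞`,
`ρ` smooth on `M × O` (`O ⊇ [0, T]` open) with `∂ₛρ = Lρ` on `[0, T]`:
`∫∫_{M×(0,T)} η² (∂ₛρ)² e^{-V} ≤ D(0) − D(T) + 4 ∫∫_{M×(0,T)} |∇η|²|∇ρ|² e^{-V}`,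
`D(s) = ∫ |∇ρ(s)|² η² e^{-V}`: `D' = 2∫g⁻¹(dρ, d(Lρ))η²e^{-V} = −2∫η²(Lρ)²e^{-V} − 4∫(Lρ)η g⁻¹(dη,dρ)e^{-V}
≤ −∫η²(Lρ)²e^{-V} + 4∫|∇η|²|∇ρ|²e^{-V}` (`deriv_gradSq_of_heatFlow_isOpen`,
`integral_mul_cutoffSq_mul_weightedLaplacian`, `neg_four_mul_mul_innerDual_le`), integrated over
`[0, T]` (FTC, Fubini). [cite: BakryGentilLedoux2014, §3.2 (pp. 141–147) and §1.4] -/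
theorem integral_derivSq_cutoffSq_le (hg : g.IsRiemannian) {V : M → ℝ}
    (hV : ContMDiff (𝓡 n) 𝓘(ℝ, ℝ) ∞ V) {η : M → ℝ} (hη : ContMDiff (𝓡 n) 𝓘(ℝ, ℝ) ∞ η)
    (hηc : HasCompactSupport η) {T : ℝ} {O : Set ℝ} {ρ : ℝ → M → ℝ} (hT : 0 < T) (hO : IsOpen O)
    (hTO : Icc 0 T ⊆ O)
    (hρ : ContMDiffOn ((𝓡 n).prod 𝓘(ℝ, ℝ)) 𝓘(ℝ, ℝ) ∞ (fun p : M × ℝ ↦ ρ p.2 p.1) (univ ×ˢ O))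
    (heq : ∀ s ∈ Icc 0 T, ∀ x, deriv (fun r ↦ ρ r x) s = g.dalembertian (ρ s) x
      - g.innerDual x (mvfderiv (𝓡 n) V x).toLinearMap (mvfderiv (𝓡 n) (ρ s) x).toLinearMap) :
    ∫ p, (deriv (fun r ↦ ρ r p.1) p.2) ^ 2 * (η p.1 ^ 2 * Real.exp (-V p.1))
        ∂(g.riemVolume.prod (volume : Measure ℝ)).restrict (univ ×ˢ Ioo 0 T) ≤
      ∫ x, g.gradSq (ρ 0) x * (η x ^ 2 * Real.exp (-V x)) ∂g.riemVolume
        - ∫ x, g.gradSq (ρ T) x * (η x ^ 2 * Real.exp (-V x)) ∂g.riemVolume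
        + 4 * ∫ p, g.gradSq (ρ p.2) p.1 * (g.gradSq η p.1 * Real.exp (-V p.1))
            ∂(g.riemVolume.prod (volume : Measure ℝ)).restrict (univ ×ˢ Ioo 0 T) := by
  haveI := CarrilloNi2009_shrinkerLSI.isFiniteMeasureOnCompacts_riemVolume hg
  haveI := sigmaFinite_riemVolume hg
  have h01 : (0 : ℝ) ≤ T := hT.le
  have h1le : (1 : ℕ∞ω) ≤ (∞ : ℕ∞ω) := WithTop.coe_le_coe.mpr le_top
  have h2le : (2 : ℕ∞ω) ≤ (∞ : ℕ∞ω) := WithTop.coe_le_coe.mpr le_top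
  set μ : Measure M := g.riemVolume with hμ
  -- the two compactly supported weights `η² e^{-V}` and `|∇η|² e^{-V}`
  have hec : Continuous fun x ↦ Real.exp (-V x) := Real.continuous_exp.comp hV.continuous.neg
  have hη2c : HasCompactSupport (fun x ↦ η x ^ 2) := by
    rw [show (fun x ↦ η x ^ 2) = fun x ↦ η x * η x from funext fun x ↦ sq (η x)]
    exact hηc.mul_right
  have hwE : Continuous fun x ↦ η x ^ 2 * Real.exp (-V x) := (hη.continuous.pow 2).mul hec
  have hwEc : HasCompactSupport fun x ↦ η x ^ 2 * Real.exp (-V x) := hη2c.mul_right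
  have hgradη : Continuous (g.gradSq η) := (contMDiff_gradSq g hη).continuous
  have hgradηs : HasCompactSupport (g.gradSq η) :=
    HasCompactSupport.intro hηc fun x hx ↦ gradSq_eq_zero_of_notMem_tsupport hx
  have hwZ : Continuous fun x ↦ g.gradSq η x * Real.exp (-V x) := hgradη.mul hec
  have hwZc : HasCompactSupport fun x ↦ g.gradSq η x * Real.exp (-V x) := hgradηs.mul_right
  -- slices, the gradient family and its time derivative
  have hslice : ∀ s ∈ O, ContMDiff (𝓡 n) 𝓘(ℝ, ℝ) ∞ (ρ s) := fun s hs ↦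
    contMDiff_slice_of_contMDiffOn hρ hs
  set Q : ℝ → M → ℝ := fun s x ↦ g.gradSq (ρ s) x with hQdef
  have hQj : ContMDiffOn ((𝓡 n).prod 𝓘(ℝ, ℝ)) 𝓘(ℝ, ℝ) ∞ (fun p : M × ℝ ↦ Q p.2 p.1) (univ ×ˢ O) :=
    contMDiffOn_gradSq_family g hO.uniqueDiffOn hρ
  have hQc : ContinuousOn (fun p : M × ℝ ↦ Q p.2 p.1) (univ ×ˢ O) := hQj.continuousOn
  have hQ'c : ContinuousOn (fun p : M × ℝ ↦ deriv (fun r ↦ Q r p.1) p.2) (univ ×ˢ O) :=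
    continuousOn_deriv_time hO hQj
  have hQd : ∀ s ∈ O, ∀ x, HasDerivAt (fun r ↦ Q r x) (deriv (fun r ↦ Q r x) s) s := fun s hs x ↦
    hasDerivAt_time hO hQj x hs
  have hρ'c : ContinuousOn (fun p : M × ℝ ↦ deriv (fun r ↦ ρ r p.1) p.2) (univ ×ˢ O) :=
    continuousOn_deriv_time hO hρ
  have hρ'2c : ContinuousOn (fun p : M × ℝ ↦ (deriv (fun r ↦ ρ r p.1) p.2) ^ 2) (univ ×ˢ O) := hρ'c.pow 2
  -- the energies
  set D : ℝ → ℝ := fun s ↦ ∫ x, Q s x * (η x ^ 2 * Real.exp (-V x)) ∂μ with hD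
  set D' : ℝ → ℝ := fun s ↦ ∫ x, deriv (fun r ↦ Q r x) s * (η x ^ 2 * Real.exp (-V x)) ∂μ with hD'
  set N : ℝ → ℝ := fun s ↦ ∫ x, (deriv (fun r ↦ ρ r x) s) ^ 2 * (η x ^ 2 * Real.exp (-V x)) ∂μ with hN
  set Z : ℝ → ℝ := fun s ↦ ∫ x, Q s x * (g.gradSq η x * Real.exp (-V x)) ∂μ with hZ
  have hDd : ∀ s ∈ O, HasDerivAt D (D' s) s := fun s hs ↦
    hasDerivAt_integral_mul_of_hasCompactSupport μ hwE hwEc hO hQc hQ'c hQd hs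
  have hD'c : ContinuousOn D' O := continuousOn_integral_mul_of_hasCompactSupport μ hwE hwEc hQ'c
  have hNc : ContinuousOn N O := continuousOn_integral_mul_of_hasCompactSupport μ hwE hwEc hρ'2c
  have hZc' : ContinuousOn Z O := continuousOn_integral_mul_of_hasCompactSupport μ hwZ hwZc hQc
  -- `D' ≤ -N + 4 Z` on `[0, T]`
  have hD'le : ∀ s ∈ Icc 0 T, D' s ≤ -N s + 4 * Z s := by
    intro s hs
    have hsO := hTO hs
    have hρs := hslice s hsO
    set Lρ : M → ℝ := fun y ↦ g.dalembertian (ρ s) y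
      - g.innerDual y (mvfderiv (𝓡 n) V y).toLinearMap (mvfderiv (𝓡 n) (ρ s) y).toLinearMap with hLρ
    have hLρs : ContMDiff (𝓡 n) 𝓘(ℝ, ℝ) ∞ Lρ := (contMDiff_dalembertian g hρs).sub (contMDiff_innerDual g hV hρs)
    -- `∂ₛ|∇ρ|² = 2 g⁻¹(dρ, d(Lρ))`
    have hQderiv : ∀ x, deriv (fun r ↦ Q r x) s =
        2 * g.innerDual x (mvfderiv (𝓡 n) (ρ s) x).toLinearMap (mvfderiv (𝓡 n) Lρ x).toLinearMap :=
      fun x ↦ deriv_gradSq_of_heatFlow_isOpen hV hO hρ hsO (heq s hs) x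
    -- the Green identity against `(Lρ) η²`
    have hid := integral_mul_cutoffSq_mul_weightedLaplacian hg (a := Lρ) hLρs hρs hη hηc hV
    have e0 : D' s = 2 * ∫ x, η x ^ 2 * g.innerDual x (mvfderiv (𝓡 n) Lρ x).toLinearMap
        (mvfderiv (𝓡 n) (ρ s) x).toLinearMap * Real.exp (-V x) ∂μ := by
      rw [hD', ← integral_const_mul]
      refine integral_congr_ae (Eventually.of_forall fun x ↦ ?_)
      dsimp only
      rw [hQderiv x, g.innerDual_comm x (mvfderiv (𝓡 n) (ρ s) x).toLinearMap (mvfderiv (𝓡 n) Lρ x).toLinearMap]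
      ring
    have e1 : ∫ x, Lρ x * η x ^ 2 * (g.dalembertian (ρ s) x
        - g.innerDual x (mvfderiv (𝓡 n) V x).toLinearMap (mvfderiv (𝓡 n) (ρ s) x).toLinearMap) *
        Real.exp (-V x) ∂μ = N s := by
      refine integral_congr_ae (Eventually.of_forall fun x ↦ ?_)
      simp only [hLρ, heq s hs x]
      ring
    -- the cross term is absorbed: `-4 X ≤ N + 4 Z`
    set X : ℝ := ∫ x, Lρ x * η x * g.innerDual x (mvfderiv (𝓡 n) η x).toLinearMap
        (mvfderiv (𝓡 n) (ρ s) x).toLinearMap * Real.exp (-V x) ∂μ with hX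
    have hIc : Continuous fun x ↦ g.innerDual x (mvfderiv (𝓡 n) η x).toLinearMap
        (mvfderiv (𝓡 n) (ρ s) x).toLinearMap :=
      continuous_innerDual_mvfderiv g (hη.of_le h1le) (hρs.of_le h1le)
    have iX : Integrable (fun x ↦ -(4 * (Lρ x * η x * g.innerDual x
        (mvfderiv (𝓡 n) η x).toLinearMap (mvfderiv (𝓡 n) (ρ s) x).toLinearMap)) * Real.exp (-V x)) μ := by
      refine integrable_of_continuous_of_hasCompactSupport' hg
        ((continuous_const.mul ((hLρs.continuous.mul hη.continuous).mul hIc)).neg.mul hec) ?_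
      exact ((((hηc.mul_left).mul_right).mul_left).neg).mul_right
    have iNZ : Integrable (fun x ↦ (η x ^ 2 * Lρ x ^ 2 + 4 * (g.gradSq η x * g.gradSq (ρ s) x))
        * Real.exp (-V x)) μ := by
      refine integrable_of_continuous_of_hasCompactSupport' hg
        ((((hη.continuous.pow 2).mul (hLρs.continuous.pow 2)).add
          (continuous_const.mul (hgradη.mul (contMDiff_gradSq g hρs).continuous))).mul hec) ?_
      refine HasCompactSupport.mul_right ?_
      exact (hη2c.mul_right).add ((hgradηs.mul_right).mul_left)
    have hmono := integral_mono iX iNZ fun x ↦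
      mul_le_mul_of_nonneg_right (neg_four_mul_mul_innerDual_le hg (ρ s) η (Lρ x) x) (Real.exp_nonneg _)
    have eX : ∫ x, -(4 * (Lρ x * η x * g.innerDual x (mvfderiv (𝓡 n) η x).toLinearMap
        (mvfderiv (𝓡 n) (ρ s) x).toLinearMap)) * Real.exp (-V x) ∂μ = -4 * X := by
      rw [hX, ← integral_const_mul]
      exact integral_congr_ae (Eventually.of_forall fun x ↦ by ring)
    have iN1 : Integrable (fun x ↦ η x ^ 2 * Lρ x ^ 2 * Real.exp (-V x)) μ :=
      integrable_of_continuous_of_hasCompactSupport' hg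
        (((hη.continuous.pow 2).mul (hLρs.continuous.pow 2)).mul hec) (hη2c.mul_right.mul_right)
    have iZ1 : Integrable (fun x ↦ 4 * (g.gradSq η x * g.gradSq (ρ s) x) * Real.exp (-V x)) μ :=
      integrable_of_continuous_of_hasCompactSupport' hg
        ((continuous_const.mul (hgradη.mul (contMDiff_gradSq g hρs).continuous)).mul hec)
        (((hgradηs.mul_right).mul_left).mul_right)
    have eN1 : ∫ x, η x ^ 2 * Lρ x ^ 2 * Real.exp (-V x) ∂μ = N s := by
      refine integral_congr_ae (Eventually.of_forall fun x ↦ ?_)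
      simp only [hLρ, heq s hs x]
      ring
    have eNZ : ∫ x, (η x ^ 2 * Lρ x ^ 2 + 4 * (g.gradSq η x * g.gradSq (ρ s) x))
        * Real.exp (-V x) ∂μ = N s + 4 * Z s := by
      have e2 : ∫ x, (η x ^ 2 * Lρ x ^ 2 + 4 * (g.gradSq η x * g.gradSq (ρ s) x))
          * Real.exp (-V x) ∂μ = ∫ x, (η x ^ 2 * Lρ x ^ 2 * Real.exp (-V x)
            + 4 * (g.gradSq η x * g.gradSq (ρ s) x) * Real.exp (-V x)) ∂μ :=
        integral_congr_ae (Eventually.of_forall fun x ↦ by ring)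
      rw [e2, integral_add iN1 iZ1, eN1]
      have e4 : ∫ x, 4 * (g.gradSq η x * g.gradSq (ρ s) x) * Real.exp (-V x) ∂μ = 4 * Z s := by
        rw [hZ, ← integral_const_mul]
        exact integral_congr_ae (Eventually.of_forall fun x ↦ by simp only [hQdef]; ring)
      rw [e4]
    rw [eX, eNZ] at hmono
    -- `D' s = -2 N s - 4 X`
    have e2 : ∫ x, η x ^ 2 * g.innerDual x (mvfderiv (𝓡 n) Lρ x).toLinearMap
        (mvfderiv (𝓡 n) (ρ s) x).toLinearMap * Real.exp (-V x) ∂μ = -N s - 2 * X := by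
      have h := hid
      rw [e1] at h
      linarith
    rw [e0, e2]
    linarith
  -- the fundamental theorem of calculus on `[0, T]` and monotonicity of the integral
  have huIcc : uIcc (0 : ℝ) T = Icc 0 T := uIcc_of_le h01
  have hFTC : ∫ s in (0 : ℝ)..T, D' s = D T - D 0 :=
    intervalIntegral.integral_eq_sub_of_hasDerivAt (fun s hs ↦ hDd s (hTO (huIcc ▸ hs)))
      ((hD'c.mono hTO).intervalIntegrable_of_Icc h01)
  have hNi : IntervalIntegrable N volume 0 T := (hNc.mono hTO).intervalIntegrable_of_Icc h01
  have hZi : IntervalIntegrable Z volume 0 T := (hZc'.mono hTO).intervalIntegrable_of_Icc h01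
  have hD'i : IntervalIntegrable D' volume 0 T := (hD'c.mono hTO).intervalIntegrable_of_Icc h01
  have hNi' : IntervalIntegrable (fun s ↦ -N s) volume 0 T := hNi.neg
  have hZi' : IntervalIntegrable (fun s ↦ 4 * Z s) volume 0 T := hZi.const_mul 4
  have hmonoI : ∫ s in (0 : ℝ)..T, D' s ≤ ∫ s in (0 : ℝ)..T, (-N s + 4 * Z s) :=
    intervalIntegral.integral_mono_on h01 hD'i (hNi'.add hZi') fun s hs ↦ hD'le s hs
  have hsplit : ∫ s in (0 : ℝ)..T, (-N s + 4 * Z s) =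
      -(∫ s in (0 : ℝ)..T, N s) + 4 * ∫ s in (0 : ℝ)..T, Z s := by
    rw [intervalIntegral.integral_add hNi' hZi', intervalIntegral.integral_neg,
      intervalIntegral.integral_const_mul]
  -- Fubini on the strip for `N` and `Z`
  have hNF : ∫ p, (deriv (fun r ↦ ρ r p.1) p.2) ^ 2 * (η p.1 ^ 2 * Real.exp (-V p.1))
      ∂(μ.prod (volume : Measure ℝ)).restrict (univ ×ˢ Ioo 0 T) = ∫ s in (0 : ℝ)..T, N s :=
    integral_strip_eq_intervalIntegral μ h01
      (integrable_strip_mul_of_hasCompactSupport μ (hρ'2c.mono (prod_mono le_rfl hTO)) hwE hwEc)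
  have hZF : ∫ p, g.gradSq (ρ p.2) p.1 * (g.gradSq η p.1 * Real.exp (-V p.1))
      ∂(μ.prod (volume : Measure ℝ)).restrict (univ ×ˢ Ioo 0 T) = ∫ s in (0 : ℝ)..T, Z s :=
    integral_strip_eq_intervalIntegral μ h01
      (integrable_strip_mul_of_hasCompactSupport μ (hQc.mono (prod_mono le_rfl hTO)) hwZ hwZc)
  have eD0 : D 0 = ∫ x, g.gradSq (ρ 0) x * (η x ^ 2 * Real.exp (-V x)) ∂μ := rfl
  have eDT : D T = ∫ x, g.gradSq (ρ T) x * (η x ^ 2 * Real.exp (-V x)) ∂μ := rfl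
  rw [hNF, hZF]
  linarith [hFTC, hsplit, hmonoI, eD0, eDT]

/-- **The time-derivative estimate for the weighted heat flow on a complete manifold, with Gaffney
cut-offs.** `V` smooth (no other assumption), `η_k ∈ C_c^∞`, `0 ≤ η_k ≤ 1`, `η_k → 1` pointwise,
`|∇η_k|² ≤ C₀/(k+1)²`; `ρ` smooth on `M × O` (`O ⊇ [0, T]` open) with `∂ₛρ = Lρ` on `[0, T]`,
`|∇ρ|² e^{-V}` integrable on the strip `M × (0, T)` and at `s = 0`. Then `(∂ₛρ)² e^{-V}` is integrable
on the strip and `∫∫_{M×(0,T)} (∂ₛρ)² e^{-V} ≤ ∫ |∇ρ(0)|² e^{-V}`. Proof: `integral_derivSq_cutoffSq_le`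
with `η = η_k`, Fatou (`η_k² → 1`) and dominated convergence.
[cite: BakryGentilLedoux2014, §3.2 (pp. 141–147) and §1.4] -/
theorem gaffney_derivEstimate (hg : g.IsRiemannian) {V : M → ℝ} (hV : ContMDiff (𝓡 n) 𝓘(ℝ, ℝ) ∞ V)
    {η : ℕ → M → ℝ} {C₀ : ℝ} (hηs : ∀ k, ContMDiff (𝓡 n) 𝓘(ℝ, ℝ) ∞ (η k))
    (hηc : ∀ k, HasCompactSupport (η k)) (hη01 : ∀ k x, 0 ≤ η k x ∧ η k x ≤ 1)
    (hη1 : ∀ x, ∀ᶠ k in atTop, η k x = 1)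
    (hηgrad : ∀ k x, g.gradSq (η k) x ≤ C₀ / ((k : ℝ) + 1) ^ 2)
    {T : ℝ} {O : Set ℝ} {ρ : ℝ → M → ℝ} (hT : 0 < T) (hO : IsOpen O) (hTO : Icc 0 T ⊆ O)
    (hρ : ContMDiffOn ((𝓡 n).prod 𝓘(ℝ, ℝ)) 𝓘(ℝ, ℝ) ∞ (fun p : M × ℝ ↦ ρ p.2 p.1) (univ ×ˢ O))
    (heq : ∀ s ∈ Icc 0 T, ∀ x, deriv (fun r ↦ ρ r x) s = g.dalembertian (ρ s) x
      - g.innerDual x (mvfderiv (𝓡 n) V x).toLinearMap (mvfderiv (𝓡 n) (ρ s) x).toLinearMap)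
    (hInt : Integrable (fun p : M × ℝ ↦ g.gradSq (ρ p.2) p.1 * Real.exp (-V p.1))
      ((g.riemVolume.prod (volume : Measure ℝ)).restrict (univ ×ˢ Ioo 0 T)))
    (h0 : Integrable (fun x ↦ g.gradSq (ρ 0) x * Real.exp (-V x)) g.riemVolume) :
    Integrable (fun p : M × ℝ ↦ (deriv (fun r ↦ ρ r p.1) p.2) ^ 2 * Real.exp (-V p.1))
        ((g.riemVolume.prod (volume : Measure ℝ)).restrict (univ ×ˢ Ioo 0 T)) ∧
      ∫ p in univ ×ˢ Ioo 0 T, (deriv (fun r ↦ ρ r p.1) p.2) ^ 2 * Real.exp (-V p.1)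
          ∂(g.riemVolume.prod (volume : Measure ℝ)) ≤
        ∫ x, g.gradSq (ρ 0) x * Real.exp (-V x) ∂g.riemVolume := by
  haveI := CarrilloNi2009_shrinkerLSI.isFiniteMeasureOnCompacts_riemVolume hg
  haveI := sigmaFinite_riemVolume hg
  set μ : Measure M := g.riemVolume with hμ
  set ν : Measure (M × ℝ) := (μ.prod (volume : Measure ℝ)).restrict (univ ×ˢ Ioo 0 T) with hν
  set A : ℝ := ∫ x, g.gradSq (ρ 0) x * Real.exp (-V x) ∂μ with hA
  set B : ℝ := ∫ p, g.gradSq (ρ p.2) p.1 * Real.exp (-V p.1) ∂ν with hB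
  set r : ℕ → ℝ := fun k ↦ ∫ p, g.gradSq (ρ p.2) p.1 * (g.gradSq (η k) p.1 * Real.exp (-V p.1)) ∂ν
    with hr
  set F : M × ℝ → ℝ := fun p ↦ (deriv (fun r ↦ ρ r p.1) p.2) ^ 2 * Real.exp (-V p.1) with hFdef
  have hec : Continuous fun x ↦ Real.exp (-V x) := Real.continuous_exp.comp hV.continuous.neg
  have hεpos : ∀ k : ℕ, (0 : ℝ) < ((k : ℝ) + 1) ^ 2 := fun k ↦ by positivity
  -- Step 1: the integrated inequality for every `k`
  have hid : ∀ k, ∫ p, (deriv (fun r ↦ ρ r p.1) p.2) ^ 2 * (η k p.1 ^ 2 * Real.exp (-V p.1)) ∂ν ≤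
      ∫ x, g.gradSq (ρ 0) x * (η k x ^ 2 * Real.exp (-V x)) ∂μ
        - ∫ x, g.gradSq (ρ T) x * (η k x ^ 2 * Real.exp (-V x)) ∂μ + 4 * r k := fun k ↦
    integral_derivSq_cutoffSq_le hg hV (hηs k) (hηc k) hT hO hTO hρ heq
  -- Step 2: `D_k(0) ≤ A`, `D_k(T) ≥ 0`
  have hsq1 : ∀ k x, η k x ^ 2 ≤ 1 := fun k x ↦ pow_le_one₀ (hη01 k x).1 (hη01 k x).2
  have hE0 : ∀ k, ∫ x, g.gradSq (ρ 0) x * (η k x ^ 2 * Real.exp (-V x)) ∂μ ≤ A := fun k ↦ by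
    refine integral_mono_of_nonneg (Eventually.of_forall fun x ↦ ?_) h0
      (Eventually.of_forall fun x ↦ ?_)
    · exact mul_nonneg (g.gradSq_nonneg hg _ _) (mul_nonneg (sq_nonneg _) (Real.exp_nonneg _))
    · exact mul_le_mul_of_nonneg_left (mul_le_of_le_one_left (Real.exp_nonneg _) (hsq1 k x))
        (g.gradSq_nonneg hg _ _)
  have hET : ∀ k, 0 ≤ ∫ x, g.gradSq (ρ T) x * (η k x ^ 2 * Real.exp (-V x)) ∂μ := fun k ↦
    integral_nonneg fun x ↦ mul_nonneg (g.gradSq_nonneg hg _ _)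
      (mul_nonneg (sq_nonneg _) (Real.exp_nonneg _))
  -- Step 3: the error terms `r k ≤ C₀/(k+1)² B`
  have hQc : ContinuousOn (fun p : M × ℝ ↦ g.gradSq (ρ p.2) p.1) (univ ×ˢ Ioo 0 T) :=
    (contMDiffOn_gradSq_family g hO.uniqueDiffOn hρ).continuousOn.mono
      (prod_mono le_rfl (Ioo_subset_Icc_self.trans hTO))
  have hgradηc : ∀ k, Continuous (g.gradSq (η k)) := fun k ↦ (contMDiff_gradSq g (hηs k)).continuous
  have hr_bound : ∀ k (p : M × ℝ), ‖g.gradSq (ρ p.2) p.1 * (g.gradSq (η k) p.1 * Real.exp (-V p.1))‖ ≤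
      C₀ / ((k : ℝ) + 1) ^ 2 * (g.gradSq (ρ p.2) p.1 * Real.exp (-V p.1)) := fun k p ↦ by
    rw [Real.norm_eq_abs, abs_of_nonneg (mul_nonneg (g.gradSq_nonneg hg _ _)
      (mul_nonneg (g.gradSq_nonneg hg _ _) (Real.exp_nonneg _)))]
    have h0' : 0 ≤ g.gradSq (ρ p.2) p.1 * Real.exp (-V p.1) :=
      mul_nonneg (g.gradSq_nonneg hg _ _) (Real.exp_nonneg _)
    calc g.gradSq (ρ p.2) p.1 * (g.gradSq (η k) p.1 * Real.exp (-V p.1))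
        = g.gradSq (η k) p.1 * (g.gradSq (ρ p.2) p.1 * Real.exp (-V p.1)) := by ring
      _ ≤ C₀ / ((k : ℝ) + 1) ^ 2 * (g.gradSq (ρ p.2) p.1 * Real.exp (-V p.1)) :=
          mul_le_mul_of_nonneg_right (hηgrad k p.1) h0'
  have hB0 : 0 ≤ B := integral_nonneg fun p ↦ mul_nonneg (g.gradSq_nonneg hg _ _) (Real.exp_nonneg _)
  have hr_le : ∀ k, r k ≤ C₀ / ((k : ℝ) + 1) ^ 2 * B := fun k ↦ by
    calc r k ≤ ‖r k‖ := Real.le_norm_self _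
      _ ≤ ∫ p, ‖g.gradSq (ρ p.2) p.1 * (g.gradSq (η k) p.1 * Real.exp (-V p.1))‖ ∂ν :=
          norm_integral_le_integral_norm _
      _ ≤ ∫ p, C₀ / ((k : ℝ) + 1) ^ 2 * (g.gradSq (ρ p.2) p.1 * Real.exp (-V p.1)) ∂ν :=
          integral_mono_of_nonneg (Eventually.of_forall fun p ↦ norm_nonneg _) (hInt.const_mul _)
            (Eventually.of_forall (hr_bound k))
      _ = C₀ / ((k : ℝ) + 1) ^ 2 * B := integral_const_mul _ _
  have hC₀B : ∀ k : ℕ, C₀ / ((k : ℝ) + 1) ^ 2 * B ≤ |C₀| * B := fun k ↦ by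
    refine mul_le_mul_of_nonneg_right ?_ hB0
    refine (le_abs_self _).trans ?_
    rw [abs_div, abs_of_pos (hεpos k)]
    refine div_le_self (abs_nonneg _) ?_
    have : (1 : ℝ) ≤ (k : ℝ) + 1 := by linarith [(Nat.cast_nonneg k : (0 : ℝ) ≤ k)]
    exact one_le_pow₀ this
  have hr_tendsto : Tendsto (fun k : ℕ ↦ C₀ / ((k : ℝ) + 1) ^ 2 * B) atTop (𝓝 0) := by
    have h1 : Tendsto (fun k : ℕ ↦ ((k : ℝ) + 1) ^ 2) atTop atTop :=
      (tendsto_pow_atTop two_ne_zero).comp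
        (tendsto_atTop_add_const_right _ 1 (tendsto_natCast_atTop_atTop (R := ℝ)))
    have h2 : Tendsto (fun k : ℕ ↦ C₀ / ((k : ℝ) + 1) ^ 2) atTop (𝓝 0) :=
      tendsto_const_nhds.div_atTop h1
    simpa using h2.mul_const B
  -- Step 4: `∫ η_k² F ≤ A + 4 r_k`
  have hI_le : ∀ k, ∫ p, η k p.1 ^ 2 * F p ∂ν ≤ A + 4 * (C₀ / ((k : ℝ) + 1) ^ 2 * B) := fun k ↦ by
    have e : ∫ p, η k p.1 ^ 2 * F p ∂ν =
        ∫ p, (deriv (fun r ↦ ρ r p.1) p.2) ^ 2 * (η k p.1 ^ 2 * Real.exp (-V p.1)) ∂ν :=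
      integral_congr_ae (Eventually.of_forall fun p ↦ by simp only [hFdef]; ring)
    rw [e]
    linarith [hid k, hE0 k, hET k, hr_le k]
  have hKbound : ∀ k, ∫ p, η k p.1 ^ 2 * F p ∂ν ≤ A + 4 * (|C₀| * B) := fun k ↦ by
    linarith [hI_le k, hC₀B k]
  -- Step 5: Fatou gives the integrability of `F = (∂ₛρ)² e^{-V}` on the strip
  have hρ'c : ContinuousOn (fun p : M × ℝ ↦ deriv (fun r ↦ ρ r p.1) p.2) (univ ×ˢ O) :=
    continuousOn_deriv_time hO hρ
  have hρ'2c : ContinuousOn (fun p : M × ℝ ↦ (deriv (fun r ↦ ρ r p.1) p.2) ^ 2) (univ ×ˢ O) := hρ'c.pow 2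
  have hFm : AEStronglyMeasurable F ν :=
    aestronglyMeasurable_strip μ ((hρ'2c.mono (prod_mono le_rfl (Ioo_subset_Icc_self.trans hTO))).mul
      (hec.comp continuous_fst).continuousOn)
  have hF0 : ∀ p, 0 ≤ F p := fun p ↦ mul_nonneg (sq_nonneg _) (Real.exp_nonneg _)
  have hχF : ∀ k, Integrable (fun p : M × ℝ ↦ η k p.1 ^ 2 * F p) ν := fun k ↦ by
    have hwk : Continuous fun x ↦ η k x ^ 2 * Real.exp (-V x) := ((hηs k).continuous.pow 2).mul hec
    have hη2c : HasCompactSupport (fun x ↦ η k x ^ 2) := by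
      rw [show (fun x ↦ η k x ^ 2) = fun x ↦ η k x * η k x from funext fun x ↦ sq (η k x)]
      exact (hηc k).mul_right
    have hwkc : HasCompactSupport fun x ↦ η k x ^ 2 * Real.exp (-V x) := hη2c.mul_right
    have h := integrable_strip_mul_of_hasCompactSupport μ (hρ'2c.mono (prod_mono le_rfl hTO))
      hwk hwkc
    exact h.congr (Eventually.of_forall fun p ↦ by simp only [hFdef]; ring)
  have hlim2 : ∀ x, Tendsto (fun k ↦ η k x ^ 2) atTop (𝓝 1) := fun x ↦ by
    simpa using (tendsto_cutoff_of_eventually_eq hη1 x).pow 2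
  have hFint : Integrable F ν :=
    CarrilloNi2009_shrinkerLSI.integrable_of_forall_integral_cutoff_mul_le hFm hF0
      (fun k p ↦ sq_nonneg (η k p.1)) hχF (fun p ↦ hlim2 p.1) (K := A + 4 * (|C₀| * B)) hKbound
  -- Step 6: `∫ η_k² F → ∫ F` (dominated convergence) and the bound
  have hI_tendsto : Tendsto (fun k ↦ ∫ p, η k p.1 ^ 2 * F p ∂ν) atTop (𝓝 (∫ p, F p ∂ν)) := by
    refine tendsto_integral_of_dominated_convergence F (fun k ↦ (hχF k).aestronglyMeasurable) hFint
      (fun k ↦ Eventually.of_forall fun p ↦ ?_) (Eventually.of_forall fun p ↦ ?_)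
    · rw [Real.norm_eq_abs, abs_of_nonneg (mul_nonneg (sq_nonneg _) (hF0 p))]
      exact mul_le_of_le_one_left (hF0 p) (hsq1 k p.1)
    · simpa using (hlim2 p.1).mul_const (F p)
  have hb_tendsto : Tendsto (fun k : ℕ ↦ A + 4 * (C₀ / ((k : ℝ) + 1) ^ 2 * B)) atTop (𝓝 (A + 4 * 0)) :=
    tendsto_const_nhds.add (hr_tendsto.const_mul 4)
  have hfinal : ∫ p, F p ∂ν ≤ A + 4 * 0 := le_of_tendsto_of_tendsto' hI_tendsto hb_tendsto hI_le
  refine ⟨hFint, ?_⟩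
  have hgoal : ∫ p, F p ∂ν ≤ A := by linarith [hfinal]
  simpa only [hFdef] using hgoal

end TimeDerivative

end Summit.SmoothPoincare4.SmoothPoincare4.Theorems.BakryEmeryComplete

end
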